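import Mathlib
import HarnessLib
import Summits.NavierStokesRegularity.NavierStokesRegularity.Theorems.PeepholeEchoDoorDoors

/-!
# PeepholeEchoDoorTwisted — S23 «PeepholeEchoDoor» ADDENDUM-22R (twisted echoes), part 5/7

§6.0–6.2: the twisted two-time defect `twoTimeDefectR` / `DefectFadesR` / `HasTwistedSymmetry` (an isometry `R ∈ O(3)` inserted, tree `IsRotatedDSS` convention; `R = 1` recovers part 1), the twisted door texts (K1-R `LocalPointZoomTwisted`, `OffDiagonalTwistedResidue`, `EchoResidueDecayAtR` / `EchoResidueDecayR`, doors `TargetOffDiagonalTwisted` / `TargetCommonTwistAllRatios` / `TargetEchoDecayAtR` / `TargetEchoDecayR`), the twisted window limit `twoTime_windowLimitR` and its analytic spreading `hasTwistedSymmetry_of_window`.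

Door family of LADDER-NS N0; THEOREMS-ONLY landing of the nsreg-p1 design `run/shared/lean/pub/ns-regularity-ideate/ns-regularity-ideate-p1/r22/Sketch23R.lean`
(ADDENDUM-22R.md). Conditional door theorems: T1-R/T2-R EVADE hard core 10661 by hypothesis, T4-DR MEETS it at the named wall (rotated half);
no route, no items (DIRECTOR-NS standing #32 (2)). WHAT THIS IS NOT: not a regularity claim; not an attack on `RotatedTypeIDSSLiouville`.
-/

noncomputable section

set_option linter.dupNamespace false

namespace Summit.NavierStokesRegularity.NavierStokesRegularity.Theorems.PeepholeEchoDoorTwisted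

open MeasureTheory Set Function Filter Topology TopologicalSpace Metric
open scoped RealInnerProductSpace NNReal ENNReal Topology Pointwise
open Literature.Analysis Literature.Analysis.FluidPDE
open Summit.NavierStokesRegularity.NavierStokesRegularity.Theorems.LocalSineTubeDoorProfileAlignedWindowRigidityAncient
open Summit.NavierStokesRegularity.NavierStokesRegularity.Theorems.PoloidalWindowDoorPoloidalWindowRigidityStrata
open Summit.NavierStokesRegularity.NavierStokesRegularity.Theorems.PoloidalWindowDoorPoloidalWindowRigidityFlat
open Summit.NavierStokesRegularity.NavierStokesRegularity.Theorems.PoloidalWindowDoorPoloidalWindowRigidityWindow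
open Summit.NavierStokesRegularity.NavierStokesRegularity.Theorems.PeepholeEchoDoorDefs
open Summit.NavierStokesRegularity.NavierStokesRegularity.Theorems.PeepholeEchoDoorCore
open Summit.NavierStokesRegularity.NavierStokesRegularity.Theorems.PeepholeEchoDoorResidues
open Summit.NavierStokesRegularity.NavierStokesRegularity.Theorems.PeepholeEchoDoorDoors

/-! ## §6 ADDENDUM-22R — TWISTED ECHOES: an isometry `R ∈ O(3)` inserted in the defect (tree `IsRotatedDSS` convention)

The second term of the two-time defect is read through the ROTATED peephole `x₀ + μ√(T−t)·R U` and rotated back: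
`‖√(T−t)·u(t, x₀+√(T−t)y) − μ√(T−t)·R⁻¹ u(t', x₀ + μ√(T−t)·R y)‖`, `t' = T − κ(T−t)`; `R = 1` is §0.  A faded twisted
defect imprints the TWISTED SYMMETRY `v(s,z) = μ R⁻¹ v(κ s, μ R z)` on the zoom profile.  OFF the NS-diagonal the Type-I rate
still kills it (isometries preserve norms; `μ = 1`: «a Type-I singularity is never a ROTATING WAVE through a peephole»);
ON the diagonal `μ = √κ` the past-cut profile is ROTATED discretely self-similar, `IsRotatedDSS (√κ)⁻¹ R⁻¹`, i.e. exactly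
the object of the SECOND conjunct of the canonical leaf `TypeIDSSLiouvilleConjecture` (`RotatedTypeIDSSLiouville`,
Bradshaw–Tsai 2017 Open Problem 5.1 for RDSS fields; Chae–Wolf 2017 Def. 1.1): the FULL leaf ⇒ no single twisted echo at
any ratio `κ ∈ (0,1)` with any twist `R`.  A COMMON twist at every ratio untwists (`(κ₁,R)·(κ₂,R)⁻¹ = (κ₁/κ₂, 1)`) ⇒ §4. -/

section Twisted

variable {ν T : ℝ} {u : ℝ → EuclideanSpace ℝ (Fin 3) → EuclideanSpace ℝ (Fin 3)} {p : ℝ → EuclideanSpace ℝ (Fin 3) → ℝ}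
  {x₀ : EuclideanSpace ℝ (Fin 3)} {C : ℝ} {v : ℝ → EuclideanSpace ℝ (Fin 3) → EuclideanSpace ℝ (Fin 3)} {lam : ℕ → ℝ}

/-- The **twisted two-time defect** with twist `R` (a linear isometry of `ℝ³`): the `(κ, μ)`-defect of §0 whose second
term is read through the rotated peephole `x₀ + μ√(T−t)·R U` and rotated back by `R⁻¹`. -/
def twoTimeDefectR (T : ℝ) (x₀ : EuclideanSpace ℝ (Fin 3)) (u : ℝ → EuclideanSpace ℝ (Fin 3) → EuclideanSpace ℝ (Fin 3))
    (κ μ : ℝ) (R : EuclideanSpace ℝ (Fin 3) ≃ₗᵢ[ℝ] EuclideanSpace ℝ (Fin 3)) (t : ℝ) (y : EuclideanSpace ℝ (Fin 3)) : ℝ :=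
  ‖Real.sqrt (T - t) • u t (x₀ + Real.sqrt (T - t) • y) -
    (μ * Real.sqrt (T - t)) • R.symm (u (T - κ * (T - t)) (x₀ + (μ * Real.sqrt (T - t)) • R y))‖

/-- **The twisted defect FADES on the window `U`.** -/
def DefectFadesR (T : ℝ) (x₀ : EuclideanSpace ℝ (Fin 3)) (u : ℝ → EuclideanSpace ℝ (Fin 3) → EuclideanSpace ℝ (Fin 3))
    (κ μ : ℝ) (R : EuclideanSpace ℝ (Fin 3) ≃ₗᵢ[ℝ] EuclideanSpace ℝ (Fin 3)) (U : Set (EuclideanSpace ℝ (Fin 3))) : Prop :=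
  Filter.Tendsto (fun t => ∫⁻ y in U, ENNReal.ofReal (twoTimeDefectR T x₀ u κ μ R t y)) (nhdsWithin T (Set.Iio T)) (nhds 0)

/-- The **twisted symmetry** `v(s, z) = μ · R⁻¹ v(κ s, μ R z)` on the open backward slab (`μ = √κ`: rotated discrete
self-similarity with factor `(√κ)⁻¹` and rotation `R⁻¹` in the tree convention `IsRotatedDSS`, after the past cut). -/
def HasTwistedSymmetry (κ μ : ℝ) (R : EuclideanSpace ℝ (Fin 3) ≃ₗᵢ[ℝ] EuclideanSpace ℝ (Fin 3))
    (v : ℝ → EuclideanSpace ℝ (Fin 3) → EuclideanSpace ℝ (Fin 3)) : Prop :=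
  ∀ s < 0, ∀ z, v s z = μ • R.symm (v (κ * s) (μ • R z))

/-- `R = 1` recovers §0. -/
theorem twoTimeDefectR_refl (κ μ t : ℝ) (y : EuclideanSpace ℝ (Fin 3)) :
    twoTimeDefectR T x₀ u κ μ (LinearIsometryEquiv.refl ℝ _) t y = twoTimeDefect T x₀ u κ μ t y := rfl

/-- `R = 1` recovers §0. -/
theorem defectFadesR_refl_iff (κ μ : ℝ) (U : Set (EuclideanSpace ℝ (Fin 3))) :
    DefectFadesR T x₀ u κ μ (LinearIsometryEquiv.refl ℝ _) U ↔ DefectFades T x₀ u κ μ U := Iff.rfl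

/-- `R = 1` recovers §0. -/
theorem hasTwistedSymmetry_refl_iff (κ μ : ℝ) :
    HasTwistedSymmetry κ μ (LinearIsometryEquiv.refl ℝ _) v ↔ HasTwoPointSymmetry κ μ v := Iff.rfl

/-! ### §6.1 Route texts (twisted) -/

/-- crux (rank 3) · K1-R · THE UNIVERSAL TWISTED ZOOM (PROVED; generalises K1 = the case `R = 1`): on the ONE door-class
profile every faded twisted defect, through any open window, at any `(κ, μ)` and any twist `R`, imprints its twisted
symmetry. -/
def LocalPointZoomTwisted : Prop :=
  ∀ (ν T : ℝ), 0 < ν → 0 < T → ∀ (u : ℝ → EuclideanSpace ℝ (Fin 3) → EuclideanSpace ℝ (Fin 3)) (p : ℝ → EuclideanSpace ℝ (Fin 3) → ℝ), Literature.Analysis.FluidPDE.IsClassicalNSSolutionOn (Set.Ico 0 T) ν 0 u p → Literature.Analysis.FluidPDE.IsLerayHopfOn T ν 0 (u 0) u → Literature.Analysis.FluidPDE.HasRapidSpatialDecay (u 0) → ∀ (x₀ : EuclideanSpace ℝ (Fin 3)) (ρ M : ℝ), 0 < ρ → (∀ t ∈ Set.Ico 0 T, T - ρ ^ 2 < t →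 ∀ x ∈ Metric.ball x₀ ρ, ‖u t x‖ * Real.sqrt (ν * (T - t)) ≤ M) → ¬ Literature.Analysis.FluidPDE.IsBackwardBoundedAt u T x₀ → ∃ (C : ℝ) (v : ℝ → EuclideanSpace ℝ (Fin 3) → EuclideanSpace ℝ (Fin 3)), Literature.Analysis.FluidPDE.HasTypeITimeDecay C v ∧ ContinuousOn (Function.uncurry v) (Set.Iio (0 : ℝ) ×ˢ Set.univ) ∧ (∀ s t : ℝ, s < t → t < 0 → ∀ x, v t x = Literature.Analysis.UnboundedOperators.heatExtension (v s) (t - s) x - Literature.Analysis.FluidPDE.oseenDuhamel 1 s v v t x) ∧ (∀ t < 0, Literature.Analysis.FluidPDE.VectorCalculus.IsDivFree (v t)) ∧ Literature.Analysis.FluidPDE.IsBackwardSingularPoint v 0 ∧ ∀ (κ μ : ℝ), 0 < κ → 0 < μ → ∀ (R : EuclideanSpace ℝ (Fin 3) ≃ₗᵢ[ℝ] EuclideanSpace ℝ (Fin 3)) (U : Set (EuclideanSpace ℝ (Fin 3))), IsOpen U → U.Nonempty → DefectFadesR T x₀ u κ μ R U → HasTwistedSymmetry κ μ R v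

/-- support (rank 9) · OFF-DIAGONAL TWISTED RESIDUE (PROVED, rate only — isometries preserve norms). -/
def OffDiagonalTwistedResidue : Prop :=
  ∀ (κ μ : ℝ), 0 < κ → 0 < μ → μ ^ 2 ≠ κ → ∀ (R : EuclideanSpace ℝ (Fin 3) ≃ₗᵢ[ℝ] EuclideanSpace ℝ (Fin 3)) (C : ℝ) (v : ℝ → EuclideanSpace ℝ (Fin 3) → EuclideanSpace ℝ (Fin 3)), Literature.Analysis.FluidPDE.HasTypeITimeDecay C v → HasTwistedSymmetry κ μ R v → ∀ t < 0, ∀ x, v t x = 0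

/-- crux (rank 2′) · K2-DR · THE TWISTED ECHO RESIDUE in the decay class at decay constant `D`, ratio `κ`, twist `R`:
IMPLIED by the wall's rotated half `Literature.Analysis.FluidPDE.RotatedTypeIDSSLiouville (√κ)⁻¹ R⁻¹`
(`echoResidueDecayAtR_of_wall`, PROVED), hence by the canonical leaf `TypeIDSSLiouvilleConjecture` (second conjunct). -/
def EchoResidueDecayAtR (D κ : ℝ) (R : EuclideanSpace ℝ (Fin 3) ≃ₗᵢ[ℝ] EuclideanSpace ℝ (Fin 3)) : Prop :=
  ∀ (C : ℝ) (v : ℝ → EuclideanSpace ℝ (Fin 3) → EuclideanSpace ℝ (Fin 3)), Literature.Analysis.FluidPDE.HasTypeITimeDecay C v → Literature.Analysis.FluidPDE.HasTypeIDecay D v → ContinuousOn (Function.uncurry v) (Set.Iio (0 : ℝ) ×ˢ Set.univ) → (∀ s t : ℝ, s < t → t < 0 → ∀ x, v t x = Literature.Analysis.UnboundedOperators.heatExtension (v s) (t - s) x - Literature.Analysis.FluidPDE.oseenDuhamel 1 s v v t x) → (∀ t < 0, Literature.Analysis.FluidPDE.VectorCalculus.IsDivFree (v t)) → HasTwistedSymmetry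 κ (Real.sqrt κ) R v → ¬ Literature.Analysis.FluidPDE.IsBackwardSingularPoint v 0

/-- crux (rank 2′) · K2-DR for every decay constant. -/
def EchoResidueDecayR (κ : ℝ) (R : EuclideanSpace ℝ (Fin 3) ≃ₗᵢ[ℝ] EuclideanSpace ℝ (Fin 3)) : Prop :=
  ∀ D : ℝ, EchoResidueDecayAtR D κ R

/-- target (rank 0) · DOOR T1-R «no off-diagonal twisted repetition» (PROVED): local Type I + ONE faded twisted
`(κ, μ, R)`-defect with `μ² ≠ κ` on ONE open window ⇒ backward bounded.  (`μ = 1`, `κ ≠ 1`, any `R`: «a Type-I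
singularity is never a rotating wave through a peephole».) -/
def TargetOffDiagonalTwisted : Prop :=
  ∀ (ν T : ℝ), 0 < ν → 0 < T → ∀ (u : ℝ → EuclideanSpace ℝ (Fin 3) → EuclideanSpace ℝ (Fin 3)) (p : ℝ → EuclideanSpace ℝ (Fin 3) → ℝ), Literature.Analysis.FluidPDE.IsClassicalNSSolutionOn (Set.Ico 0 T) ν 0 u p → Literature.Analysis.FluidPDE.IsLerayHopfOn T ν 0 (u 0) u → Literature.Analysis.FluidPDE.HasRapidSpatialDecay (u 0) → ∀ (x₀ : EuclideanSpace ℝ (Fin 3)) (ρ M : ℝ), 0 < ρ → (∀ t ∈ Set.Ico 0 T, T - ρ ^ 2 < t → ∀ x ∈ Metric.ball x₀ ρ, ‖u t x‖ * Real.sqrt (ν * (T - t)) ≤ M) → ∀ (κ μ : ℝ), 0 < κ → 0 < μ → μ ^ 2 ≠ κ → ∀ (R : EuclideanSpace ℝ (Fin 3) ≃ₗᵢ[ℝ] EuclideanSpace ℝ (Fin 3)) (U : Set (EuclideanSpace ℝ (Fin 3))), IsOpen U → U.Nonempty → DefectFadesR T x₀ u κ μ R U → Literature.Analysis.FluidPDE.IsBackwardBoundedAt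 u T x₀

/-- target (rank 0) · DOOR T2-R «no total echo with a common twist» (PROVED): local Type I + twisted echoes at EVERY
ratio `κ ∈ (0,1)` with one and the same twist `R` ⇒ backward bounded (two of them untwist each other). -/
def TargetCommonTwistAllRatios : Prop :=
  ∀ (ν T : ℝ), 0 < ν → 0 < T → ∀ (u : ℝ → EuclideanSpace ℝ (Fin 3) → EuclideanSpace ℝ (Fin 3)) (p : ℝ → EuclideanSpace ℝ (Fin 3) → ℝ), Literature.Analysis.FluidPDE.IsClassicalNSSolutionOn (Set.Ico 0 T) ν 0 u p → Literature.Analysis.FluidPDE.IsLerayHopfOn T ν 0 (u 0) u → Literature.Analysis.FluidPDE.HasRapidSpatialDecay (u 0) → ∀ (x₀ : EuclideanSpace ℝ (Fin 3)) (ρ M : ℝ), 0 < ρ → (∀ t ∈ Set.Ico 0 T, T - ρ ^ 2 < t → ∀ x ∈ Metric.ball x₀ ρ, ‖u t x‖ * Real.sqrt (ν * (T - t)) ≤ M) → ∀ (R : EuclideanSpace ℝ (Fin 3) ≃ₗᵢ[ℝ] EuclideanSpace ℝ (Fin 3)), (∀ κ : ℝ, 0 < κ → κ < 1 → ∃ U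 : Set (EuclideanSpace ℝ (Fin 3)), IsOpen U ∧ U.Nonempty ∧ DefectFadesR T x₀ u κ (Real.sqrt κ) R U) → Literature.Analysis.FluidPDE.IsBackwardBoundedAt u T x₀

/-- target (rank 0) · DOOR T4-DR «no single twisted echo» at ratio `κ`, twist `R`, SPACE–time local Type I with constants
`ν, M` (CONDITIONAL on `EchoResidueDecayAtR (M/ν) κ R`; hence on the wall's rotated half `RotatedTypeIDSSLiouville (√κ)⁻¹ R⁻¹`). -/
def TargetEchoDecayAtR (ν M κ : ℝ) (R : EuclideanSpace ℝ (Fin 3) ≃ₗᵢ[ℝ] EuclideanSpace ℝ (Fin 3)) : Prop :=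
  ∀ (T : ℝ), 0 < T → ∀ (u : ℝ → EuclideanSpace ℝ (Fin 3) → EuclideanSpace ℝ (Fin 3)) (p : ℝ → EuclideanSpace ℝ (Fin 3) → ℝ), Literature.Analysis.FluidPDE.IsClassicalNSSolutionOn (Set.Ico 0 T) ν 0 u p → Literature.Analysis.FluidPDE.IsLerayHopfOn T ν 0 (u 0) u → Literature.Analysis.FluidPDE.HasRapidSpatialDecay (u 0) → ∀ (x₀ : EuclideanSpace ℝ (Fin 3)) (ρ : ℝ), 0 < ρ → (∀ t ∈ Set.Ico 0 T, T - ρ ^ 2 < t → ∀ x ∈ Metric.ball x₀ ρ, ‖u t x‖ * (‖x - x₀‖ + Real.sqrt (ν * (T - t))) ≤ M) → ∀ (U : Set (EuclideanSpace ℝ (Fin 3))), IsOpen U → U.Nonempty → DefectFadesR T x₀ u κ (Real.sqrt κ) R U → Literature.Analysis.FluidPDE.IsBackwardBoundedAt u T x₀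

/-- target (rank 0) · DOOR T4-DR for all constants (CONDITIONAL on `EchoResidueDecayR κ R`, hence on the wall's rotated
half — `targetEchoDecayR_of_wall` — and on the canonical leaf — `targetEchoDecayR_of_conjecture`). -/
def TargetEchoDecayR (κ : ℝ) (R : EuclideanSpace ℝ (Fin 3) ≃ₗᵢ[ℝ] EuclideanSpace ℝ (Fin 3)) : Prop :=
  ∀ (ν M : ℝ), 0 < ν → TargetEchoDecayAtR ν M κ R

/-! ### §6.2 The twisted window limit and its spreading -/

/-- **TWISTED WINDOW LIMIT** (Fatou through the peephole, the second field read through `R`). -/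
theorem twoTime_windowLimitR (hν : 0 < ν) (hT : 0 < T) (hcl : IsClassicalNSSolutionOn (Ico 0 T) ν 0 u p)
    (hlam : ∀ j, 0 < lam j) (hlam0 : Tendsto lam atTop (𝓝 0))
    (hslice : ∀ s < 0, Continuous (v s))
    (hconv : ∀ s < 0, ∀ y,
      Tendsto (fun j => (lam j / ν) • u (T + lam j ^ 2 * s / ν) (x₀ + lam j • y)) atTop (𝓝 (v s y)))
    {κ μ : ℝ} (hκ : 0 < κ) (R : EuclideanSpace ℝ (Fin 3) ≃ₗᵢ[ℝ] EuclideanSpace ℝ (Fin 3))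
    {U : Set (EuclideanSpace ℝ (Fin 3))} (hU : IsOpen U)
    (hfade : DefectFadesR T x₀ u κ μ R U) {s : ℝ} (hs : s < 0) {y : EuclideanSpace ℝ (Fin 3)} (hy : y ∈ U) :
    (Real.sqrt (-s) / Real.sqrt ν * ν) • v s ((Real.sqrt (-s) / Real.sqrt ν) • y) =
      (μ * (Real.sqrt (-s) / Real.sqrt ν) * ν) • R.symm (v (κ * s) ((μ * (Real.sqrt (-s) / Real.sqrt ν)) • R y)) := by
  have hns : 0 < -s := neg_pos.2 hs
  have hκs : κ * s < 0 := mul_neg_of_pos_of_neg hκ hs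
  obtain ⟨t, ht⟩ : ∃ t : ℕ → ℝ, ∀ j, t j = T + lam j ^ 2 * s / ν := ⟨_, fun j => rfl⟩
  have hTt : ∀ j, T - t j = lam j ^ 2 * (-s) / ν := fun j => by rw [ht j]; ring
  have ht' : ∀ j, T - κ * (T - t j) = T + lam j ^ 2 * (κ * s) / ν := fun j => by rw [ht j]; ring
  have hc : ∀ j, 0 < lam j ^ 2 * (-s) / ν := fun j => div_pos (mul_pos (pow_pos (hlam j) 2) hns) hν
  have hc0 : Tendsto (fun j => lam j ^ 2 * (-s) / ν) atTop (𝓝 0) := by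
    simpa using ((hlam0.pow 2).mul_const (-s)).div_const ν
  have htT : Tendsto t atTop (𝓝[<] T) := by
    refine tendsto_nhdsWithin_iff.2 ⟨?_, Eventually.of_forall fun j => ?_⟩
    · have h1 : Tendsto (fun j => T - lam j ^ 2 * (-s) / ν) atTop (𝓝 (T - 0)) :=
        tendsto_const_nhds.sub hc0
      rw [sub_zero] at h1
      refine h1.congr fun j => ?_
      rw [ht j]; ring
    · show t j < T
      have h1 := hc j
      rw [← hTt j] at h1
      linarith
  have htT' : Tendsto (fun j => T - κ * (T - t j)) atTop (𝓝[<] T) := by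
    refine tendsto_nhdsWithin_iff.2 ⟨?_, Eventually.of_forall fun j => ?_⟩
    · have h1 : Tendsto (fun j => T - κ * (lam j ^ 2 * (-s) / ν)) atTop (𝓝 (T - κ * 0)) :=
        tendsto_const_nhds.sub (hc0.const_mul κ)
      rw [mul_zero, sub_zero] at h1
      refine h1.congr fun j => ?_
      rw [hTt j]
    · show T - κ * (T - t j) < T
      have h1 := mul_pos hκ (hc j)
      rw [← hTt j] at h1
      linarith
  have hev : ∀ᶠ j in atTop, t j ∈ Set.Ioo 0 T ∧ T - κ * (T - t j) ∈ Set.Ioo 0 T :=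
    (htT.eventually (Ioo_mem_nhdsLT hT)).and (htT'.eventually (Ioo_mem_nhdsLT hT))
  obtain ⟨j₀, hj₀⟩ := eventually_atTop.1 hev
  have hshift : Tendsto (fun j : ℕ => j + j₀) atTop atTop := tendsto_add_atTop_nat j₀
  have hfadej : Tendsto (fun j => ∫⁻ y in U, ENNReal.ofReal (twoTimeDefectR T x₀ u κ μ R (t (j + j₀)) y))
      atTop (𝓝 0) := (hfade.comp htT).comp hshift
  set σ : ℝ := Real.sqrt (-s) / Real.sqrt ν with hσ
  have hσpos : 0 < σ := div_pos (Real.sqrt_pos.2 hns) (Real.sqrt_pos.2 hν)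
  have hsq : ∀ j, Real.sqrt (T - t j) = lam j * σ := by
    intro j
    rw [hTt j, hσ, Real.sqrt_div' _ hν.le, Real.sqrt_mul (pow_nonneg (hlam j).le 2),
      Real.sqrt_sq (hlam j).le]
    ring
  set W : ℕ → EuclideanSpace ℝ (Fin 3) → EuclideanSpace ℝ (Fin 3) := fun j y =>
    Real.sqrt (T - t (j + j₀)) • u (t (j + j₀)) (x₀ + Real.sqrt (T - t (j + j₀)) • y) with hWdef
  have hW : ∀ (j : ℕ) (y : EuclideanSpace ℝ (Fin 3)), W j y =
      (σ * ν) • ((lam (j + j₀) / ν) • u (T + lam (j + j₀) ^ 2 * s / ν)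
        (x₀ + lam (j + j₀) • (σ • y))) := by
    intro j y
    simp only [hWdef, hsq (j + j₀), smul_smul]
    rw [ht (j + j₀)]
    congr 1
    field_simp
  set W' : ℕ → EuclideanSpace ℝ (Fin 3) → EuclideanSpace ℝ (Fin 3) := fun j y =>
    (μ * Real.sqrt (T - t (j + j₀))) • R.symm (u (T - κ * (T - t (j + j₀)))
      (x₀ + (μ * Real.sqrt (T - t (j + j₀))) • R y)) with hW'def
  have hW' : ∀ (j : ℕ) (y : EuclideanSpace ℝ (Fin 3)), W' j y =
      (μ * σ * ν) • R.symm ((lam (j + j₀) / ν) • u (T + lam (j + j₀) ^ 2 * (κ * s) / ν)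
        (x₀ + lam (j + j₀) • ((μ * σ) • R y))) := by
    intro j y
    simp only [hW'def, hsq (j + j₀), LinearIsometryEquiv.map_smul, smul_smul]
    rw [ht' (j + j₀)]
    have hpt : (μ * (lam (j + j₀) * σ)) • R y = (lam (j + j₀) * (μ * σ)) • R y := by
      congr 1
      ring
    have hsc : μ * (lam (j + j₀) * σ) = μ * σ * ν * (lam (j + j₀) / ν) := by
      field_simp
    rw [hpt, hsc]
  set Hs : EuclideanSpace ℝ (Fin 3) → ℝ := fun y =>
    ‖(σ * ν) • v s (σ • y) - (μ * σ * ν) • R.symm (v (κ * s) ((μ * σ) • R y))‖ with hHsdef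
  have hvs : Continuous (v s) := hslice s hs
  have hvs' : Continuous (v (κ * s)) := hslice (κ * s) hκs
  have hHscont : Continuous Hs := by
    show Continuous fun y => ‖(σ * ν) • v s (σ • y) - (μ * σ * ν) • R.symm (v (κ * s) ((μ * σ) • R y))‖
    exact (((hvs.comp (continuous_const_smul σ)).const_smul (σ * ν)).sub
      ((R.symm.continuous.comp (hvs'.comp ((continuous_const_smul (μ * σ)).comp R.continuous))).const_smul
        (μ * σ * ν))).norm
  have hconvW : ∀ y, Tendsto (fun j => W j y) atTop (𝓝 ((σ * ν) • v s (σ • y))) := by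
    intro y
    have h := ((hconv s hs (σ • y)).comp hshift).const_smul (σ * ν)
    exact h.congr fun j => (hW j y).symm
  have hconvW' : ∀ y, Tendsto (fun j => W' j y) atTop
      (𝓝 ((μ * σ * ν) • R.symm (v (κ * s) ((μ * σ) • R y)))) := by
    intro y
    have h := ((R.symm.continuous.tendsto _).comp
      ((hconv (κ * s) hκs ((μ * σ) • R y)).comp hshift)).const_smul (μ * σ * ν)
    exact h.congr fun j => (hW' j y).symm
  have hconvH : ∀ y, Tendsto (fun j => ‖W j y - W' j y‖) atTop (𝓝 (Hs y)) := fun y =>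
    ((hconvW y).sub (hconvW' y)).norm
  have hmem : ∀ j, t (j + j₀) ∈ Set.Ico 0 T := fun j =>
    ⟨((hj₀ (j + j₀) (Nat.le_add_left _ _)).1).1.le, ((hj₀ (j + j₀) (Nat.le_add_left _ _)).1).2⟩
  have hmem' : ∀ j, T - κ * (T - t (j + j₀)) ∈ Set.Ico 0 T := fun j =>
    ⟨((hj₀ (j + j₀) (Nat.le_add_left _ _)).2).1.le, ((hj₀ (j + j₀) (Nat.le_add_left _ _)).2).2⟩
  have hφ : ∀ c : ℝ, Continuous fun y : EuclideanSpace ℝ (Fin 3) => x₀ + c • y :=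
    fun c => continuous_const.add (continuous_const_smul _)
  have hWc : ∀ j, Continuous (W j) := fun j => by
    show Continuous fun y => Real.sqrt (T - t (j + j₀)) • u (t (j + j₀)) (x₀ + Real.sqrt (T - t (j + j₀)) • y)
    exact ((hcl.contDiff_velocity (hmem j)).continuous.comp (hφ _)).const_smul (Real.sqrt (T - t (j + j₀)))
  have hW'c : ∀ j, Continuous (W' j) := fun j => by
    show Continuous fun y => (μ * Real.sqrt (T - t (j + j₀))) • R.symm (u (T - κ * (T - t (j + j₀)))
      (x₀ + (μ * Real.sqrt (T - t (j + j₀))) • R y))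
    exact (R.symm.continuous.comp (((hcl.contDiff_velocity (hmem' j)).continuous.comp
      ((hφ _).comp R.continuous)))).const_smul (μ * Real.sqrt (T - t (j + j₀)))
  have hFjc : ∀ j, Continuous fun y => ‖W j y - W' j y‖ := fun j => ((hWc j).sub (hW'c j)).norm
  have hdefect : ∀ j y, twoTimeDefectR T x₀ u κ μ R (t (j + j₀)) y = ‖W j y - W' j y‖ := fun j y => rfl
  set g : EuclideanSpace ℝ (Fin 3) → ℝ≥0∞ := fun y => ENNReal.ofReal (Hs y) with hg
  have hgc : Continuous g := ENNReal.continuous_ofReal.comp hHscont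
  have hgjm : ∀ j, Measurable fun y => ENNReal.ofReal ‖W j y - W' j y‖ :=
    fun j => (ENNReal.continuous_ofReal.comp (hFjc j)).measurable
  have hptw : ∀ y, Tendsto (fun j => ENNReal.ofReal ‖W j y - W' j y‖) atTop (𝓝 (g y)) :=
    fun y => ENNReal.tendsto_ofReal (hconvH y)
  have hFatou : ∫⁻ y in U, liminf (fun j => ENNReal.ofReal ‖W j y - W' j y‖) atTop ≤
      liminf (fun j => ∫⁻ y in U, ENNReal.ofReal ‖W j y - W' j y‖) atTop :=
    lintegral_liminf_le' (fun j => (hgjm j).aemeasurable)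
  have hlim : (fun y => liminf (fun j => ENNReal.ofReal ‖W j y - W' j y‖) atTop) = g :=
    funext fun y => (hptw y).liminf_eq
  have hfadeW : Tendsto (fun j => ∫⁻ y in U, ENNReal.ofReal ‖W j y - W' j y‖) atTop (𝓝 0) := by
    refine hfadej.congr fun j => ?_
    simp only [hdefect]
  rw [hlim, hfadeW.liminf_eq] at hFatou
  have hint : ∫⁻ y in U, g y = 0 := le_antisymm hFatou bot_le
  have hae : ∀ᵐ y ∂(volume.restrict U), g y = 0 := (lintegral_eq_zero_iff hgc.measurable).1 hint
  rw [ae_restrict_iff' hU.measurableSet] at hae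
  have hzero : ∀ y ∈ U, g y = 0 := by
    intro y hy
    by_contra hne
    set O : Set (EuclideanSpace ℝ (Fin 3)) := U ∩ g ⁻¹' (Ioi 0) with hO
    have hOo : IsOpen O := hU.inter (isOpen_Ioi.preimage hgc)
    have hO0 : volume O = 0 := by
      rw [measure_eq_zero_iff_ae_notMem]
      filter_upwards [hae] with y' hy'
      rintro ⟨h1, h2⟩
      have := hy' h1
      simp only [mem_preimage, mem_Ioi, this, lt_self_iff_false] at h2
    have hOe : O = ∅ := (hOo.measure_eq_zero_iff volume).1 hO0
    have hyO : y ∈ O := ⟨hy, by simpa [mem_preimage, mem_Ioi, pos_iff_ne_zero] using hne⟩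
    rw [hOe] at hyO
    exact hyO
  have h := hzero y hy
  simp only [hg, ENNReal.ofReal_eq_zero] at h
  have h0 : Hs y = 0 := le_antisymm h (norm_nonneg _)
  have h1 : (σ * ν) • v s (σ • y) - (μ * σ * ν) • R.symm (v (κ * s) ((μ * σ) • R y)) = 0 := norm_eq_zero.1 h0
  exact sub_eq_zero.1 h1

/-- Linear isometries are real-analytic maps. -/
theorem analyticAt_linearIsometryEquiv (R : EuclideanSpace ℝ (Fin 3) ≃ₗᵢ[ℝ] EuclideanSpace ℝ (Fin 3))
    (w : EuclideanSpace ℝ (Fin 3)) : AnalyticAt ℝ (fun z : EuclideanSpace ℝ (Fin 3) => R z) w := by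
  have h := R.toLinearIsometry.toContinuousLinearMap.analyticAt w
  simpa using h

/-- **SPREADING (twisted)** by slice analyticity: the twisted window identity on an open nonempty `U` for every
`s < 0` upgrades to the twisted symmetry on the whole slab. -/
theorem hasTwistedSymmetry_of_window (hrate : HasTypeITimeDecay C v)
    (hcont : ContinuousOn (uncurry v) (Iio (0 : ℝ) ×ˢ univ))
    (hmild : ∀ s t : ℝ, s < t → t < 0 → ∀ x,
      v t x = UnboundedOperators.heatExtension (v s) (t - s) x - oseenDuhamel 1 s v v t x)
    (hν : 0 < ν) {κ μ : ℝ} (hκ : 0 < κ) (R : EuclideanSpace ℝ (Fin 3) ≃ₗᵢ[ℝ] EuclideanSpace ℝ (Fin 3))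
    {U : Set (EuclideanSpace ℝ (Fin 3))} (hU : IsOpen U) (hUne : U.Nonempty)
    (hwin : ∀ s < 0, ∀ y ∈ U, (Real.sqrt (-s) / Real.sqrt ν * ν) • v s ((Real.sqrt (-s) / Real.sqrt ν) • y) =
      (μ * (Real.sqrt (-s) / Real.sqrt ν) * ν) • R.symm (v (κ * s) ((μ * (Real.sqrt (-s) / Real.sqrt ν)) • R y))) :
    HasTwistedSymmetry κ μ R v := by
  intro s hs z
  have hns : 0 < -s := neg_pos.2 hs
  have hκs : κ * s < 0 := mul_neg_of_pos_of_neg hκ hs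
  set σ : ℝ := Real.sqrt (-s) / Real.sqrt ν with hσ
  have hσpos : 0 < σ := div_pos (Real.sqrt_pos.2 hns) (Real.sqrt_pos.2 hν)
  have hσν : σ * ν ≠ 0 := mul_ne_zero hσpos.ne' hν.ne'
  have hwin' : ∀ w ∈ σ • U, v s w = μ • R.symm (v (κ * s) (μ • R w)) := by
    rintro w ⟨y, hy, rfl⟩
    have h := hwin s hs y hy
    have h2 : (μ * σ * ν) • R.symm (v (κ * s) ((μ * σ) • R y)) =
        (σ * ν) • (μ • R.symm (v (κ * s) (μ • R (σ • y)))) := by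
      rw [LinearIsometryEquiv.map_smul, smul_smul, smul_smul, show σ * ν * μ = μ * σ * ν by ring]
    rw [h2] at h
    exact smul_right_injective _ hσν h
  have hbdd := bdd_of_hasTypeITimeDecay hrate
  have han1 : AnalyticOnNhd ℝ (v s) univ := analyticOnNhd_slice hcont hbdd hmild hs
  have han2 : AnalyticOnNhd ℝ (v (κ * s)) univ := analyticOnNhd_slice hcont hbdd hmild hκs
  have hanIn : AnalyticOnNhd ℝ (fun w : EuclideanSpace ℝ (Fin 3) => μ • R w) univ := fun w _ =>
    (analyticAt_linearIsometryEquiv R w).const_smul (c := μ)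
  have hcomp : AnalyticOnNhd ℝ (v (κ * s) ∘ fun w : EuclideanSpace ℝ (Fin 3) => μ • R w) univ :=
    han2.comp hanIn (fun _ _ => mem_univ _)
  have han3 : AnalyticOnNhd ℝ (fun w => μ • R.symm (v (κ * s) (μ • R w))) univ := fun w hw =>
    ((analyticAt_linearIsometryEquiv R.symm _).comp (hcomp w hw)).const_smul (c := μ)
  set f : EuclideanSpace ℝ (Fin 3) → EuclideanSpace ℝ (Fin 3) := fun w => v s w - μ • R.symm (v (κ * s) (μ • R w))
    with hf
  have hfan : AnalyticOnNhd ℝ f univ := han1.sub han3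
  obtain ⟨y₀, hy₀⟩ := hUne
  have hOpen : IsOpen (σ • U) := hU.smul₀ hσpos.ne'
  have hmem0 : σ • y₀ ∈ σ • U := smul_mem_smul_set hy₀
  have hfz : f =ᶠ[𝓝 (σ • y₀)] 0 := by
    filter_upwards [hOpen.mem_nhds hmem0] with w hw
    simp only [hf, Pi.zero_apply, sub_eq_zero]
    exact hwin' w hw
  have hEq : EqOn f 0 univ :=
    hfan.eqOn_zero_of_preconnected_of_eventuallyEq_zero isPreconnected_univ (mem_univ _) hfz
  have := hEq (mem_univ z)
  simp only [hf, Pi.zero_apply, sub_eq_zero] at this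
  exact this

end Twisted


end Summit.NavierStokesRegularity.NavierStokesRegularity.Theorems.PeepholeEchoDoorTwisted

end
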